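import Literature.AlgebraicGeometry.Resolution.RegularLocalRingsJacobian
import Mathlib.FieldTheory.KummerPolynomial
import Mathlib.RingTheory.AdjoinRoot
import Mathlib.Algebra.MvPolynomial.Equiv
import Mathlib.RingTheory.Polynomial.Quotient
import Mathlib.RingTheory.Localization.Away.Basic
import HarnessLib

/-!
# [OURS · L1 W4.2] E2 chart calculus, brick 8: THE CORE OF (N2′) — an anisotropic binary quadratic form `X₀² − μX₁²`
# (`μ` not a square) is a regular parameter of `κ[X]` at every prime off `V(X₀, X₁)` (crux chain w42, cell k2 `T3insep` =
# `stub_isoInsepTower`; `--supports stmt-ResolutionOfSingularities-19249`)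

OURS (cell res-hironaka, slot W4.2, seat res-D-pv-042; OWN OBJECT TUO 18:19Z); NOT a statement of [Hironaka2017] nor of
[CossartJannsenSaito2020] / [CossartPiltant2008]. AI-drafted, weaker than expert review. PROOF file, def-free, fact-free.
Pure commutative algebra over a field `κ` (any characteristic), `P = κ[X_k : k ∈ ι]`, `ι` finite:

* `localRingHom_bijective_of_torsion_cokernel` — localization comparison: for an injective ring map `φ : A → C` whose cokernel is
  killed by powers of `φ t` and a prime `𝔮 ∌ φ t`, the induced map `A_{φ⁻¹𝔮} → C_𝔮` is bijective.
* `isRegularRing_quotient_X_sq_sub_C` — `P/(X_i² − μ) ≅ κ(√μ)[X_k : k ≠ i]` is a regular ring when `μ` is not a square.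
* `X_sq_sub_C_not_mem_maximalIdeal_sq` — hence `X_i² − μ ∉ 𝔭²P_𝔭` for EVERY prime `𝔭` (Matsumura 14.2, Literature
  `not_isRegularLocalRing_quotient_span_singleton_of_mem_sq` + `isRegularLocalRing_localization_quotient_span_singleton`).
* `X_sq_sub_C_mul_X_sq_not_mem_maximalIdeal_sq_of_right` / `_of_left` — `X_{i₀}² − μX_{i₁}² ∉ 𝔭²P_𝔭` whenever `X_{i₁} ∉ 𝔭`
  (resp. `X_{i₀} ∉ 𝔭`): the substitution `X_{i₀} ↦ X_{i₀}/X_{i₁}` identifies `P_𝔭` with a localization of `P` at a prime `𝔭′`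
  carrying `X_{i₀}² − μ` to a unit multiple of the form.
* `X_mem_and_X_mem_of_mem_maximalIdeal_sq` — **the (N2′) core**: `X_{i₀}² − μX_{i₁}² ∈ 𝔭²P_𝔭 ⇒ X_{i₀}, X_{i₁} ∈ 𝔭`; and the two
  degenerate chart shapes `one_sub_C_mul_X_sq_not_mem_maximalIdeal_sq` (`1 − μX_i²`), `X_sq_sub_C_not_mem_maximalIdeal_sq`.
-/

noncomputable section

set_option linter.dupNamespace false

open scoped Classical
open IsLocalRing MvPolynomial Literature.AlgebraicGeometry.Resolution

namespace Summit.ResolutionOfSingularities.ResolutionOfSingularities.Cruxes.SigmaMaxModifications.IdeasL1C6.E2Chart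

universe u v

/-! ## §0. Two transport helpers for local homomorphisms -/

/-- A local homomorphism maps `𝔪_A²` into `𝔪_B²`. [folklore] -/
theorem map_mem_maximalIdeal_sq {A B : Type*} [CommRing A] [CommRing B] [IsLocalRing A] [IsLocalRing B]
    (f : A →+* B) [IsLocalHom f] {a : A} (ha : a ∈ maximalIdeal A ^ 2) : f a ∈ maximalIdeal B ^ 2 := by
  have h1 : (maximalIdeal A).map f ≤ maximalIdeal B := map_maximalIdeal_le f
  have h2 : f a ∈ ((maximalIdeal A).map f) ^ 2 := by
    rw [← Ideal.map_pow]; exact Ideal.mem_map_of_mem f ha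
  exact Ideal.pow_right_mono h1 2 h2

/-- Along a ring isomorphism of local rings, membership in `𝔪²` is reflected. [folklore] -/
theorem mem_maximalIdeal_sq_of_ringEquiv {A B : Type*} [CommRing A] [CommRing B] [IsLocalRing A] [IsLocalRing B]
    (e : A ≃+* B) {a : A} (ha : e a ∈ maximalIdeal B ^ 2) : a ∈ maximalIdeal A ^ 2 := by
  have := map_mem_maximalIdeal_sq (e.symm : B →+* A) ha
  simpa using this

/-! ## §1. Localization comparison -/

/-- **Localization comparison.** Let `φ : A → C` be an injective ring map such that every element of `C` is carried into the image
of `φ` by a power of `φ t` (the cokernel is `t`-power torsion), `𝔮` a prime of `C` not containing `φ t` and `I = φ⁻¹𝔮`. Then the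
induced local map `A_I → C_𝔮` is bijective. [folklore] -/
theorem localRingHom_bijective_of_torsion_cokernel {A C : Type*} [CommRing A] [CommRing C] (φ : A →+* C)
    (hφ : Function.Injective φ) (t : A) (htors : ∀ c : C, ∃ (n : ℕ) (a : A), φ a = φ t ^ n * c)
    (𝔮 : Ideal C) [𝔮.IsPrime] (ht : φ t ∉ 𝔮) (I : Ideal A) [I.IsPrime] (hI : I = 𝔮.comap φ) :
    Function.Bijective (Localization.localRingHom I 𝔮 φ hI) := by
  have htn : ∀ n : ℕ, φ t ^ n ∉ 𝔮 := fun n hn => ht (‹𝔮.IsPrime›.mem_of_pow_mem n hn)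
  constructor
  · -- injective
    rw [injective_iff_map_eq_zero]
    intro z hz
    obtain ⟨x, y, rfl⟩ := IsLocalization.exists_mk'_eq I.primeCompl z
    rw [Localization.localRingHom_mk', IsLocalization.mk'_eq_zero_iff] at hz
    obtain ⟨⟨m, hm⟩, hmx⟩ := hz
    obtain ⟨n, a, ha⟩ := htors m
    have hax : a * x = 0 := by
      apply hφ
      rw [map_mul, ha, map_zero, mul_assoc, hmx, mul_zero]
    have haI : a ∉ I := by
      rw [hI, Ideal.mem_comap, ha]
      exact fun h => (‹𝔮.IsPrime›.mem_or_mem h).elim (htn n) hm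
    exact (IsLocalization.mk'_eq_zero_iff x y).mpr ⟨⟨a, haI⟩, hax⟩
  · -- surjective
    intro z
    obtain ⟨c, s, rfl⟩ := IsLocalization.exists_mk'_eq 𝔮.primeCompl z
    obtain ⟨n₁, a₁, ha₁⟩ := htors c
    obtain ⟨n₂, a₂, ha₂⟩ := htors (s : C)
    have hs : (s : C) ∉ 𝔮 := s.2
    have hden : t ^ n₁ * a₂ ∉ I := by
      rw [hI, Ideal.mem_comap, map_mul, map_pow, ha₂]
      intro h
      rcases ‹𝔮.IsPrime›.mem_or_mem h with h | h
      · exact htn n₁ h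
      · exact (‹𝔮.IsPrime›.mem_or_mem h).elim (htn n₂) hs
    refine ⟨IsLocalization.mk' (Localization.AtPrime I) (t ^ n₂ * a₁) (⟨t ^ n₁ * a₂, hden⟩ : I.primeCompl), ?_⟩
    rw [Localization.localRingHom_mk', IsLocalization.mk'_eq_iff_eq]
    simp only [map_mul, map_pow, ha₁, ha₂]
    ring

/-! ## §2. `P/(X_i² − μ)` is a regular ring; `X_i² − μ` is a regular parameter at every prime -/

section Core

variable {κ : Type u} [Field κ] {ι : Type v}

/-- `μ ≠ 0` when `μ` is not a square. [folklore] -/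
theorem ne_zero_of_not_sq {μ : κ} (hμ : ∀ b : κ, b ^ 2 ≠ μ) : μ ≠ 0 := fun h => hμ 0 (by rw [h]; ring)

/-- `X_i² − μ ≠ 0` in `κ[X]` when `μ` is not a square. [folklore] -/
theorem X_sq_sub_C_ne_zero {μ : κ} (hμ : ∀ b : κ, b ^ 2 ≠ μ) (i : ι) : (X i ^ 2 - C μ : MvPolynomial ι κ) ≠ 0 := by
  intro h
  have hX : coeff (0 : ι →₀ ℕ) (X i ^ 2 : MvPolynomial ι κ) = 0 := by
    rw [X_pow_eq_monomial, coeff_monomial, if_neg (Finsupp.single_ne_zero.mpr two_ne_zero)]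
  have := congrArg (coeff (0 : ι →₀ ℕ)) h
  rw [coeff_sub, hX, coeff_C, if_pos rfl, coeff_zero, zero_sub, neg_eq_zero] at this
  exact ne_zero_of_not_sq hμ this

/-- The inverse of a non-square is a non-square. [folklore] -/
theorem not_sq_inv {μ : κ} (hμ : ∀ b : κ, b ^ 2 ≠ μ) : ∀ b : κ, b ^ 2 ≠ μ⁻¹ := by
  intro b hb
  have hμ0 := ne_zero_of_not_sq hμ
  have hb0 : b ≠ 0 := by
    rintro rfl
    rw [zero_pow two_ne_zero] at hb
    exact inv_ne_zero hμ0 hb.symm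
  refine hμ b⁻¹ ?_
  rw [inv_pow, hb, inv_inv]

variable [Fintype ι] [DecidableEq ι]

/-- **`P/(X_i² − μ)` is a regular ring** when `μ` is not a square: it is `κ(√μ)[X_k : k ≠ i]`, a polynomial ring over the field
`κ[S]/(S² − μ)` (Mathlib: polynomial rings over regular rings are regular). [folklore] -/
theorem isRegularRing_quotient_X_sq_sub_C {μ : κ} (hμ : ∀ b : κ, b ^ 2 ≠ μ) (i : ι) :
    IsRegularRing (MvPolynomial ι κ ⧸ Ideal.span {(X i ^ 2 - C μ : MvPolynomial ι κ)}) := by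
  set g : Polynomial κ := Polynomial.X ^ 2 - Polynomial.C μ with hg
  haveI : Fact (Irreducible g) := ⟨X_pow_sub_C_irreducible_of_prime Nat.prime_two hμ⟩
  -- `P ≅ κ[S][X_k : k ≠ i]`, `X_i ↦ S`
  let e₁ : MvPolynomial ι κ ≃ₐ[κ] MvPolynomial {k : ι // k ≠ i} (Polynomial κ) :=
    (renameEquiv κ (Equiv.optionSubtypeNe i).symm).trans (optionEquivRight κ {k : ι // k ≠ i})
  have he₁ : e₁ (X i ^ 2 - C μ) = C g := by
    have hXi : e₁ (X i) = C Polynomial.X := by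
      change optionEquivRight κ {k : ι // k ≠ i} (rename (Equiv.optionSubtypeNe i).symm (X i)) = _
      rw [rename_X, Equiv.optionSubtypeNe_symm_self, optionEquivRight_X_none]
    have hC : e₁ (C μ) = C (Polynomial.C μ) := by
      change optionEquivRight κ {k : ι // k ≠ i} (rename (Equiv.optionSubtypeNe i).symm (C μ)) = _
      rw [rename_C, optionEquivRight_C]
    rw [map_sub, map_pow, hXi, hC, hg, C_sub, C_pow]
  have hmap : (Ideal.map (C : Polynomial κ →+* MvPolynomial {k : ι // k ≠ i} (Polynomial κ)) (Ideal.span {g})) =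
      Ideal.map (e₁ : MvPolynomial ι κ →+* MvPolynomial {k : ι // k ≠ i} (Polynomial κ))
        (Ideal.span {(X i ^ 2 - C μ : MvPolynomial ι κ)}) := by
    rw [Ideal.map_span, Set.image_singleton, Ideal.map_span, Set.image_singleton]
    exact congrArg (fun x => Ideal.span {x}) (by exact_mod_cast he₁.symm)
  let e₂ : (MvPolynomial ι κ ⧸ Ideal.span {(X i ^ 2 - C μ : MvPolynomial ι κ)}) ≃+*
      MvPolynomial {k : ι // k ≠ i} (Polynomial κ) ⧸
        (Ideal.map (C : Polynomial κ →+* MvPolynomial {k : ι // k ≠ i} (Polynomial κ)) (Ideal.span {g})) :=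
    Ideal.quotientEquiv _ _ e₁.toRingEquiv hmap
  let e₃ : (MvPolynomial {k : ι // k ≠ i} (Polynomial κ) ⧸
        (Ideal.map (C : Polynomial κ →+* MvPolynomial {k : ι // k ≠ i} (Polynomial κ)) (Ideal.span {g}))) ≃+*
      MvPolynomial {k : ι // k ≠ i} (AdjoinRoot g) :=
    (quotientEquivQuotientMvPolynomial (Ideal.span {g})).symm.toRingEquiv
  haveI : IsRegularRing (MvPolynomial {k : ι // k ≠ i} (AdjoinRoot g)) := inferInstance
  exact IsRegularRing.of_ringEquiv (e₂.trans e₃).symm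

/-- Transport of a regularity statement along an equality of primes (the localization depends on the `IsPrime` instance only
through a proposition). [folklore] -/
theorem isRegularLocalRing_quotient_congr_prime {A : Type*} [CommRing A] {𝔭 𝔮 : Ideal A} [𝔭.IsPrime] [𝔮.IsPrime]
    (h : 𝔭 = 𝔮) (f : A)
    (hreg : IsRegularLocalRing (Localization.AtPrime 𝔭 ⧸ Ideal.span {algebraMap A (Localization.AtPrime 𝔭) f})) :
    IsRegularLocalRing (Localization.AtPrime 𝔮 ⧸ Ideal.span {algebraMap A (Localization.AtPrime 𝔮) f}) := by
  subst h
  exact hreg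

/-- **`X_i² − μ` is a regular parameter at every prime**: for `μ` not a square and any prime `𝔭` of `P = κ[X]`, the image of
`X_i² − μ` in `P_𝔭` does not lie in `𝔪²` (if it lies in `𝔭` at all, `P_𝔭/(X_i² − μ) = (P/(X_i² − μ))_𝔭` is regular; Matsumura 14.2).
[folklore] -/
theorem X_sq_sub_C_not_mem_maximalIdeal_sq {μ : κ} (hμ : ∀ b : κ, b ^ 2 ≠ μ) (i : ι) (𝔭 : Ideal (MvPolynomial ι κ))
    [𝔭.IsPrime] :
    algebraMap (MvPolynomial ι κ) (Localization.AtPrime 𝔭) (X i ^ 2 - C μ) ∉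
      maximalIdeal (Localization.AtPrime 𝔭) ^ 2 := by
  set q : MvPolynomial ι κ := X i ^ 2 - C μ with hq
  intro hmem
  by_cases hq𝔭 : q ∈ 𝔭
  · -- `P_𝔭/(q) ≅ (P/(q))_{𝔭/(q)}` is regular
    set mk := Ideal.Quotient.mk (Ideal.span {q}) with hmk
    have hker : RingHom.ker mk ≤ 𝔭 := by
      rw [hmk, Ideal.mk_ker]; exact (Ideal.span_singleton_le_iff_mem _).mpr hq𝔭
    haveI h𝔭' : (𝔭.map mk).IsPrime := Ideal.map_isPrime_of_surjective Ideal.Quotient.mk_surjective hker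
    have hcomap : (𝔭.map mk).comap mk = 𝔭 := by
      rw [Ideal.comap_map_of_surjective _ Ideal.Quotient.mk_surjective, ← RingHom.ker_eq_comap_bot]
      exact sup_eq_left.mpr hker
    haveI := isRegularRing_quotient_X_sq_sub_C hμ i
    have key := isRegularLocalRing_localization_quotient_span_singleton q (𝔭.map mk)
    have key' := isRegularLocalRing_quotient_congr_prime hcomap q key
    -- but `0 ≠ q ∈ 𝔪²`
    haveI : IsDomain (MvPolynomial ι κ) := inferInstance
    have hq0 : algebraMap (MvPolynomial ι κ) (Localization.AtPrime 𝔭) q ≠ 0 := by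
      intro h0
      have hinj := IsLocalization.injective (Localization.AtPrime 𝔭) 𝔭.primeCompl_le_nonZeroDivisors
      exact X_sq_sub_C_ne_zero hμ i (hinj (by rw [h0, map_zero]))
    exact not_isRegularLocalRing_quotient_span_singleton_of_mem_sq hq0 hmem key'
  · -- `q` is a unit in `P_𝔭`
    have hu : IsUnit (algebraMap (MvPolynomial ι κ) (Localization.AtPrime 𝔭) q) :=
      IsLocalization.map_units (Localization.AtPrime 𝔭) (⟨q, hq𝔭⟩ : 𝔭.primeCompl)
    exact (IsLocalRing.mem_maximalIdeal _).mp (Ideal.pow_le_self two_ne_zero hmem) hu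

/-! ## §3. The binary form `X_{i₀}² − μX_{i₁}²` off `V(X_{i₁})`: the substitution `X_{i₀} ↦ X_{i₀}/X_{i₁}` -/

/-- **`X_{i₀}² − μX_{i₁}²` is a regular parameter at every prime not containing `X_{i₁}`.** For `μ` not a square, `i₀ ≠ i₁` and a
prime `𝔭 ∌ X_{i₁}` of `P = κ[X]`, the image of `X_{i₀}² − μX_{i₁}²` in `P_𝔭` is not in `𝔪²`: in `C = P[1/X_{i₁}]` it is
`X_{i₁}² · φ(X_{i₀}² − μ)` for the substitution `φ : X_{i₀} ↦ X_{i₀}/X_{i₁}`, and `φ` induces an isomorphism `P_{𝔭′} ≅ C_𝔮 ≅ P_𝔭`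
(`𝔮 = 𝔭C`, `𝔭′ = φ⁻¹𝔮`) carrying `X_{i₀}² − μ` — a regular parameter at `𝔭′` — to a unit multiple of the form. [folklore] -/
theorem X_sq_sub_C_mul_X_sq_not_mem_maximalIdeal_sq_of_right {μ : κ} (hμ : ∀ b : κ, b ^ 2 ≠ μ) {i₀ i₁ : ι} (hne : i₀ ≠ i₁)
    (𝔭 : Ideal (MvPolynomial ι κ)) [𝔭.IsPrime] (h₁ : (X i₁ : MvPolynomial ι κ) ∉ 𝔭) :
    algebraMap (MvPolynomial ι κ) (Localization.AtPrime 𝔭) (X i₀ ^ 2 - C μ * X i₁ ^ 2) ∉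
      maximalIdeal (Localization.AtPrime 𝔭) ^ 2 := by
  -- notation
  set P := MvPolynomial ι κ with hP
  set C' := Localization.Away (X i₁ : MvPolynomial ι κ) with hC'
  set alg : MvPolynomial ι κ →+* C' := algebraMap (MvPolynomial ι κ) C' with halg
  haveI : IsDomain (MvPolynomial ι κ) := inferInstance
  have hX0 : (X i₁ : MvPolynomial ι κ) ≠ 0 := X_ne_zero i₁
  have halg_inj : Function.Injective alg :=
    IsLocalization.injective C' (powers_le_nonZeroDivisors_of_noZeroDivisors hX0)
  have hunit : IsUnit (alg (X i₁)) := IsLocalization.Away.algebraMap_isUnit (X i₁ : MvPolynomial ι κ)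
  have hmi : alg (X i₁) * IsLocalization.Away.invSelf (X i₁ : MvPolynomial ι κ) = 1 := IsLocalization.Away.mul_invSelf _
  -- the substitution `φ : X_{i₀} ↦ X_{i₀}/X_{i₁}` and its quasi-inverse `θ : X_{i₀} ↦ X_{i₀}X_{i₁}`
  set φ : MvPolynomial ι κ →+* C' := eval₂Hom (alg.comp C)
    (fun k => if k = i₀ then alg (X i₀) * IsLocalization.Away.invSelf (X i₁ : MvPolynomial ι κ) else alg (X k)) with hφ
  set θ : MvPolynomial ι κ →+* MvPolynomial ι κ := eval₂Hom C (fun k => if k = i₀ then X i₀ * X i₁ else X k) with hθ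
  have hφC : ∀ a : κ, φ (C a) = alg (C a) := fun a => by rw [hφ, eval₂Hom_C, RingHom.comp_apply]
  have hφX₀ : φ (X i₀) = alg (X i₀) * IsLocalization.Away.invSelf (X i₁ : MvPolynomial ι κ) := by
    rw [hφ, eval₂Hom_X', if_pos rfl]
  have hφX : ∀ k, k ≠ i₀ → φ (X k) = alg (X k) := fun k hk => by rw [hφ, eval₂Hom_X', if_neg hk]
  have hφX₁ : φ (X i₁) = alg (X i₁) := hφX i₁ (Ne.symm hne)
  have hθC : ∀ a : κ, θ (C a) = C a := fun a => by rw [hθ, eval₂Hom_C]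
  have hθX₀ : θ (X i₀) = X i₀ * X i₁ := by rw [hθ, eval₂Hom_X', if_pos rfl]
  have hθX : ∀ k, k ≠ i₀ → θ (X k) = X k := fun k hk => by rw [hθ, eval₂Hom_X', if_neg hk]
  -- `φ ∘ θ = alg`
  have hφθ : φ.comp θ = alg := by
    refine ringHom_ext (fun a => ?_) (fun k => ?_)
    · rw [RingHom.comp_apply, hθC, hφC]
    · by_cases hk : k = i₀
      · subst hk
        rw [RingHom.comp_apply, hθX₀, map_mul, hφX₀, hφX₁, mul_assoc,
          mul_comm (IsLocalization.Away.invSelf _) , hmi, mul_one]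
      · rw [RingHom.comp_apply, hθX k hk, hφX k hk]
  -- `φ` is injective: `ψ ∘ φ = alg` for the extension `ψ` of `alg ∘ θ` to `C`
  have hφ_inj : Function.Injective φ := by
    have hu : IsUnit ((alg.comp θ) (X i₁)) := by
      rw [RingHom.comp_apply, hθX i₁ (Ne.symm hne)]; exact hunit
    set ψ : C' →+* C' := IsLocalization.Away.lift (X i₁ : MvPolynomial ι κ) hu with hψ
    have hψalg : ∀ a, ψ (alg a) = alg (θ a) := fun a => by
      rw [hψ]
      exact IsLocalization.Away.lift_eq (X i₁ : MvPolynomial ι κ) hu a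
    have hψinv : ψ (IsLocalization.Away.invSelf (X i₁ : MvPolynomial ι κ)) =
        IsLocalization.Away.invSelf (X i₁ : MvPolynomial ι κ) := by
      have h1 : ψ (alg (X i₁)) * ψ (IsLocalization.Away.invSelf (X i₁ : MvPolynomial ι κ)) = 1 := by
        rw [← map_mul, hmi, map_one]
      rw [hψalg, hθX i₁ (Ne.symm hne)] at h1
      -- both are inverses of the unit `alg (X i₁)`
      calc ψ (IsLocalization.Away.invSelf (X i₁ : MvPolynomial ι κ))
          = (alg (X i₁) * IsLocalization.Away.invSelf (X i₁ : MvPolynomial ι κ)) *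
              ψ (IsLocalization.Away.invSelf (X i₁ : MvPolynomial ι κ)) := by rw [hmi, one_mul]
        _ = IsLocalization.Away.invSelf (X i₁ : MvPolynomial ι κ) *
              (alg (X i₁) * ψ (IsLocalization.Away.invSelf (X i₁ : MvPolynomial ι κ))) := by ring
        _ = IsLocalization.Away.invSelf (X i₁ : MvPolynomial ι κ) := by rw [h1, mul_one]
    have hψφ : ψ.comp φ = alg := by
      refine ringHom_ext (fun a => ?_) (fun k => ?_)
      · rw [RingHom.comp_apply, hφC, hψalg, hθC]
      · by_cases hk : k = i₀
        · subst hk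
          rw [RingHom.comp_apply, hφX₀, map_mul, hψalg, hθX₀, hψinv, map_mul, mul_assoc, hmi, mul_one]
        · rw [RingHom.comp_apply, hφX k hk, hψalg, hθX k hk]
    intro a b hab
    apply halg_inj
    rw [← hψφ, RingHom.comp_apply, RingHom.comp_apply, hab]
  -- the cokernel of `φ` is `X_{i₁}`-power torsion
  have htors : ∀ c : C', ∃ (n : ℕ) (a : MvPolynomial ι κ), φ a = φ (X i₁) ^ n * c := by
    intro c
    obtain ⟨⟨g, ⟨_, ⟨n, rfl⟩⟩⟩, hc⟩ := IsLocalization.surj (Submonoid.powers (X i₁ : MvPolynomial ι κ)) c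
    refine ⟨n, θ g, ?_⟩
    change c * alg (X i₁ ^ n) = alg g at hc
    rw [← RingHom.comp_apply, hφθ, ← hc, hφX₁, map_pow, mul_comm]
  -- the prime `𝔮 = 𝔭C` of `C` and `𝔭′ = φ⁻¹𝔮`
  have hdisj : Disjoint (Submonoid.powers (X i₁ : MvPolynomial ι κ) : Set (MvPolynomial ι κ)) (𝔭 : Set (MvPolynomial ι κ)) := by
    rw [Set.disjoint_left]
    rintro _ ⟨n, rfl⟩ hn
    exact h₁ (‹𝔭.IsPrime›.mem_of_pow_mem n hn)
  set 𝔮 : Ideal C' := 𝔭.map alg with h𝔮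
  haveI h𝔮p : 𝔮.IsPrime := IsLocalization.isPrime_of_isPrime_disjoint _ C' 𝔭 ‹_› hdisj
  have h𝔮𝔭 : 𝔮.comap alg = 𝔭 := IsLocalization.under_map_of_isPrime_disjoint _ C' ‹𝔭.IsPrime› hdisj
  have hX𝔮 : alg (X i₁) ∉ 𝔮 := fun h => h₁ (by rw [← h𝔮𝔭]; exact h)
  have hφX𝔮 : φ (X i₁) ∉ 𝔮 := by rw [hφX₁]; exact hX𝔮
  set 𝔭' : Ideal (MvPolynomial ι κ) := 𝔮.comap φ with h𝔭'
  -- the two local isomorphisms `P_𝔭 ≅ C_𝔮 ≅ P_𝔭′`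
  have halgtors : ∀ c : C', ∃ (n : ℕ) (a : MvPolynomial ι κ), alg a = alg (X i₁) ^ n * c := by
    intro c
    obtain ⟨⟨g, ⟨_, ⟨n, rfl⟩⟩⟩, hc⟩ := IsLocalization.surj (Submonoid.powers (X i₁ : MvPolynomial ι κ)) c
    exact ⟨n, g, by change c * alg (X i₁ ^ n) = alg g at hc; rw [← hc, map_pow, mul_comm]⟩
  let e₀ : Localization.AtPrime 𝔭 ≃+* Localization.AtPrime 𝔮 :=
    RingEquiv.ofBijective (Localization.localRingHom 𝔭 𝔮 alg h𝔮𝔭.symm)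
      (localRingHom_bijective_of_torsion_cokernel alg halg_inj (X i₁) halgtors 𝔮 hX𝔮 𝔭 h𝔮𝔭.symm)
  let e₁ : Localization.AtPrime 𝔭' ≃+* Localization.AtPrime 𝔮 :=
    RingEquiv.ofBijective (Localization.localRingHom 𝔭' 𝔮 φ rfl)
      (localRingHom_bijective_of_torsion_cokernel φ hφ_inj (X i₁) htors 𝔮 hφX𝔮 𝔭' rfl)
  -- the identity `alg (X_{i₀}² − μX_{i₁}²) = alg (X_{i₁})² · φ (X_{i₀}² − μ)`
  have hident : alg (X i₀ ^ 2 - C μ * X i₁ ^ 2) = alg (X i₁) ^ 2 * φ (X i₀ ^ 2 - C μ) := by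
    have e1 : φ (X i₀ ^ 2 - C μ) = (alg (X i₀) * IsLocalization.Away.invSelf (X i₁ : MvPolynomial ι κ)) ^ 2 - alg (C μ) := by
      rw [map_sub, map_pow, hφX₀, hφC]
    rw [e1, map_sub, map_mul, map_pow, map_pow]
    have : alg (X i₁) ^ 2 * (alg (X i₀) * IsLocalization.Away.invSelf (X i₁ : MvPolynomial ι κ)) ^ 2 =
        alg (X i₀) ^ 2 * (alg (X i₁) * IsLocalization.Away.invSelf (X i₁ : MvPolynomial ι κ)) ^ 2 := by ring
    rw [mul_sub, this, hmi, one_pow, mul_one, mul_comm (alg (X i₁) ^ 2)]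
  -- now suppose the form lies in `𝔪²` at `𝔭`
  intro hmem
  -- in `C_𝔮`
  have h1 : algebraMap C' (Localization.AtPrime 𝔮) (alg (X i₀ ^ 2 - C μ * X i₁ ^ 2)) ∈
      maximalIdeal (Localization.AtPrime 𝔮) ^ 2 := by
    have := map_mem_maximalIdeal_sq (e₀ : Localization.AtPrime 𝔭 →+* Localization.AtPrime 𝔮) hmem
    rwa [show (e₀ : Localization.AtPrime 𝔭 →+* Localization.AtPrime 𝔮)
        (algebraMap (MvPolynomial ι κ) (Localization.AtPrime 𝔭) (X i₀ ^ 2 - C μ * X i₁ ^ 2)) =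
        algebraMap C' (Localization.AtPrime 𝔮) (alg (X i₀ ^ 2 - C μ * X i₁ ^ 2)) from
      Localization.localRingHom_to_map 𝔭 𝔮 alg h𝔮𝔭.symm _] at this
  rw [hident, map_mul, map_pow] at h1
  have hu𝔮 : IsUnit (algebraMap C' (Localization.AtPrime 𝔮) (alg (X i₁))) :=
    IsLocalization.map_units (Localization.AtPrime 𝔮) (⟨alg (X i₁), hX𝔮⟩ : 𝔮.primeCompl)
  have h2 : algebraMap C' (Localization.AtPrime 𝔮) (φ (X i₀ ^ 2 - C μ)) ∈ maximalIdeal (Localization.AtPrime 𝔮) ^ 2 := by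
    obtain ⟨w, hw⟩ := (hu𝔮.pow 2)
    have := Ideal.mul_mem_left _ (↑w⁻¹ : Localization.AtPrime 𝔮) h1
    rwa [← hw, ← mul_assoc, Units.inv_mul, one_mul] at this
  -- pull back to `P_𝔭′`
  have h3 : algebraMap (MvPolynomial ι κ) (Localization.AtPrime 𝔭') (X i₀ ^ 2 - C μ) ∈
      maximalIdeal (Localization.AtPrime 𝔭') ^ 2 := by
    refine mem_maximalIdeal_sq_of_ringEquiv e₁ ?_
    rw [show (e₁ (algebraMap (MvPolynomial ι κ) (Localization.AtPrime 𝔭') (X i₀ ^ 2 - C μ))) =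
        algebraMap C' (Localization.AtPrime 𝔮) (φ (X i₀ ^ 2 - C μ)) from Localization.localRingHom_to_map 𝔭' 𝔮 φ rfl _]
    exact h2
  exact X_sq_sub_C_not_mem_maximalIdeal_sq hμ i₀ 𝔭' h3

/-- The same off `V(X_{i₀})`: `X_{i₀}² − μX_{i₁}² = −μ·(X_{i₁}² − μ⁻¹X_{i₀}²)` and `μ⁻¹` is again a non-square. [folklore] -/
theorem X_sq_sub_C_mul_X_sq_not_mem_maximalIdeal_sq_of_left {μ : κ} (hμ : ∀ b : κ, b ^ 2 ≠ μ) {i₀ i₁ : ι} (hne : i₀ ≠ i₁)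
    (𝔭 : Ideal (MvPolynomial ι κ)) [𝔭.IsPrime] (h₀ : (X i₀ : MvPolynomial ι κ) ∉ 𝔭) :
    algebraMap (MvPolynomial ι κ) (Localization.AtPrime 𝔭) (X i₀ ^ 2 - C μ * X i₁ ^ 2) ∉
      maximalIdeal (Localization.AtPrime 𝔭) ^ 2 := by
  have hμ0 := ne_zero_of_not_sq hμ
  have key := X_sq_sub_C_mul_X_sq_not_mem_maximalIdeal_sq_of_right (not_sq_inv hμ) (Ne.symm hne) 𝔭 h₀
  intro hmem
  apply key
  have hid : (X i₁ ^ 2 - C μ⁻¹ * X i₀ ^ 2 : MvPolynomial ι κ) = -C μ⁻¹ * (X i₀ ^ 2 - C μ * X i₁ ^ 2) := by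
    have : (C μ⁻¹ * C μ : MvPolynomial ι κ) = 1 := by
      rw [← C_mul, inv_mul_cancel₀ hμ0, C_1]
    linear_combination (-(X i₁ ^ 2 : MvPolynomial ι κ)) * this
  rw [hid, map_mul]
  exact Ideal.mul_mem_left _ _ hmem

/-- **THE (N2′) CORE.** For `μ` not a square in the field `κ`, indices `i₀ ≠ i₁` and a prime `𝔭` of `κ[X]`: if the anisotropic form
`X_{i₀}² − μX_{i₁}²` lies in `𝔭²κ[X]_𝔭` then `X_{i₀} ∈ 𝔭` and `X_{i₁} ∈ 𝔭`. [OURS · L1 W4.2 · k2 · E2 chart calculus, brick 8] [folklore] -/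
theorem X_mem_and_X_mem_of_mem_maximalIdeal_sq {μ : κ} (hμ : ∀ b : κ, b ^ 2 ≠ μ) {i₀ i₁ : ι} (hne : i₀ ≠ i₁)
    (𝔭 : Ideal (MvPolynomial ι κ)) [𝔭.IsPrime]
    (h : algebraMap (MvPolynomial ι κ) (Localization.AtPrime 𝔭) (X i₀ ^ 2 - C μ * X i₁ ^ 2) ∈
      maximalIdeal (Localization.AtPrime 𝔭) ^ 2) :
    (X i₀ : MvPolynomial ι κ) ∈ 𝔭 ∧ (X i₁ : MvPolynomial ι κ) ∈ 𝔭 := by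
  constructor
  · by_contra h₀
    exact X_sq_sub_C_mul_X_sq_not_mem_maximalIdeal_sq_of_left hμ hne 𝔭 h₀ h
  · by_contra h₁
    exact X_sq_sub_C_mul_X_sq_not_mem_maximalIdeal_sq_of_right hμ hne 𝔭 h₁ h

/-- Degenerate chart shape `1 − μX_i² = −μ·(X_i² − μ⁻¹)`: never in `𝔪²`. [folklore] -/
theorem one_sub_C_mul_X_sq_not_mem_maximalIdeal_sq {μ : κ} (hμ : ∀ b : κ, b ^ 2 ≠ μ) (i : ι)
    (𝔭 : Ideal (MvPolynomial ι κ)) [𝔭.IsPrime] :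
    algebraMap (MvPolynomial ι κ) (Localization.AtPrime 𝔭) (1 - C μ * X i ^ 2) ∉ maximalIdeal (Localization.AtPrime 𝔭) ^ 2 := by
  have hμ0 := ne_zero_of_not_sq hμ
  have key := X_sq_sub_C_not_mem_maximalIdeal_sq (not_sq_inv hμ) i 𝔭
  intro hmem
  apply key
  have hid : (X i ^ 2 - C μ⁻¹ : MvPolynomial ι κ) = -C μ⁻¹ * (1 - C μ * X i ^ 2) := by
    have : (C μ⁻¹ * C μ : MvPolynomial ι κ) = 1 := by
      rw [← C_mul, inv_mul_cancel₀ hμ0, C_1]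
    linear_combination (-(X i ^ 2 : MvPolynomial ι κ)) * this
  rw [hid, map_mul]
  exact Ideal.mul_mem_left _ _ hmem

end Core

end Summit.ResolutionOfSingularities.ResolutionOfSingularities.Cruxes.SigmaMaxModifications.IdeasL1C6.E2Chart

end
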